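import Literature.NumberTheory.Automorphic.JacquetLanglandsSurjectivePerConstituent
import Literature.NumberTheory.Automorphic.GLnPlacesSplittingOperators
import Literature.NumberTheory.Automorphic.GLnLocalPiIntegratedOperator
import HarnessLib

/-!
# The "onto" half of Jacquet–Langlands for a cuspidal `π`, from a matched `*`-algebra of test
# functions with a FIXED ramified factor `ξ_S`
(Gelbart, *Automorphic forms on adele groups* (1975), Thm. 10.5 (ii) and its proof, pp. 151–156:
`Φ_f = ξ_S ⊗ f`, `ξ_S = ⊗_{v ∈ S} f_v` fixed normalised matrix coefficients (10.11), `f` ranging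
over `C_c^∞(G^S)`; Jacquet–Langlands, LNM 114 (1970), §16)

Topic `NumberTheory/Automorphic`; theorems only (no definition, no named fact, no instance
visible to importers). In Gelbart's proof of Thm. 10.5 the comparison of the trace formulas
(10.14) = (10.15) is applied to test functions `Φ = ξ_S ⊗ f` on `G_𝔸 = G_S × G^S` whose factor
at the finite set `S = Ram(D)` is **one fixed function** `ξ_S` (a self-adjoint idempotent, so that
these `Φ` form a `*`-algebra under convolution matched with the `Φ' = ξ'_S ⊗ f` on the division
algebra side), and the first step is that `R(ξ_S ⊗ f)` does not vanish on the cuspidal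
constituent `π` under consideration (the space `M ∩ π ≠ 0`, p. 152). This file records that
reduction in the tree's vocabulary:

* `ClosedSubrep.coe_toContRep_integratedOperator_apply` — the integrated operator of the
  restriction `W.toContRep` of a unitary representation to a closed invariant subspace is the
  restriction of the integrated operator (`(W.toContRep)(Φ) y = R(Φ) y` in `H`).
* `exists_discreteAutomorphicRep_of_ramifiedFactor` — **for a cuspidal `π` of `GL₂(𝔸_K)`, a
  finite set `S` of finite places and `Ξ ∈ C_c(G_S)` with `(π ∘ ι_S)(Ξ) ≠ 0`, a matched
  `*`-algebra `𝒜` of test-function pairs (closed under involution, convolution and the matched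
  translations at `v ∉ Ram_f(D)`, carrying the Hilbert–Schmidt trace inequality, as in
  `exists_discreteAutomorphicRep_of_testAlgebra`) which contains, for every neighbourhood `N` of
  `1`, some pair `(Φ', Ξ ⊗ θ)` with `θ ≥ 0` continuous compactly supported, `θ(1) > 0`,
  `supp θ ⊆ N`, yields an irreducible `πD ≤ L²(D_𝔸ˣ ⧸ ℝ_{>0} Dˣ)` of dimension `≠ 1`
  Hecke-compatible with `π` away from every finite set of places** — the non-vanishing input being
  `GLn.exists_nhds_integratedOperator_placesTestFunction_ne_zero` (`GLnPlacesSplittingOperators`).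
* `exists_discreteAutomorphicRep_of_localFactors` — the same with `Ξ = ⊗_{v ∈ S} ξ_v`
  (`GLn.tensorCc`) and the hypothesis placed on the single places: `(π ∘ ι_v)(ξ_v) ≠ 0` for
  `v ∈ S` (`GLn.integratedOperator_toAdelicPi_tensorCc_ne_zero`, `GLnLocalPiIntegratedOperator`,
  which rests on the irreducibility of `π`: `LocalOperatorsProductNonvanishing`); for a local
  component `ρ_v` of `π` at `v` through an injective intertwiner `f_v` that hypothesis holds as
  soon as `∫ ξ_v ũ(ρ_v(g) x) ≠ 0` for some `x`, `ũ` (`integratedOperator_restrict_apply_ne_zero`,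
  `IntegratedOperatorLocalNonvanishing`) — e.g. for Gelbart's `ξ_v = d · conj ⟪ρ_v(g)u, u⟫`
  (cut off to `v(det) = 0`), by positivity.

So, for any cuspidal `π` and any finite `S`, the conclusion of
`Literature.NumberTheory.Automorphic.jacquetLanglands_transfer_surjective` for `π` is reduced to
the matched `*`-algebra `{(ξ'_S ⊗ f', ξ_S ⊗ f)}` with its Hilbert–Schmidt trace inequality — the
comparison (10.14) = (10.15) of trace formulas with the transfer `G^S ≅ G'^S` and the local
correspondence at `S = Ram(D)` ((10.8), (10.16)–(10.22)) — and to the choice of local factors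
`ξ_v` not killed by `π_v`. Part of the inline (D-0026) decomposition of that named fact.

## References

* S. Gelbart, *Automorphic forms on adele groups*, Ann. of Math. Studies 83 (1975), Thm. 10.5 (ii),
  pp. 151–156, (10.10)–(10.15) [Gelbart1975].
* H. Jacquet, R. P. Langlands, *Automorphic forms on `GL(2)`*, LNM 114 (1970), §16, Thm. 16.1,
  Lemma 16.1.1 [JacquetLanglands1970].
-/

noncomputable section

open scoped TensorProduct MatrixGroups NNReal ENNReal InnerProductSpace
open NumberField IsDedekindDomain MeasureTheory Measure TopologicalSpace CompactlySupported Filter Topology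
open Literature.NumberTheory.Automorphic

universe u

namespace Literature.NumberTheory.Automorphic

/-! ### The integrated operator of a closed subrepresentation -/

section Subrep

variable {G H : Type*} [Group G] [TopologicalSpace G] [MeasurableSpace G] [BorelSpace G]
  [NormedAddCommGroup H] [InnerProductSpace ℂ H] [CompleteSpace H]

/-- **`(W.toContRep)(Φ) y = R(Φ) y`**: the integrated operator of the restriction of a unitary
strongly continuous representation `π` to a closed invariant subspace `W` is the restriction of
the integrated operator of `π` (the inclusion `W ↪ H` commutes with Bochner integrals). [folklore] -/
theorem ClosedSubrep.coe_toContRep_integratedOperator_apply {π : ContRepresentation ℂ G H}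
    (hu : π.IsUnitary) (hc : π.IsStronglyContinuous) (W : ContRepresentation.ClosedSubrep π)
    (hu' : W.toContRep.IsUnitary) (hc' : W.toContRep.IsStronglyContinuous)
    (η : Measure G) [IsFiniteMeasureOnCompacts η] (f : C_c(G, ℂ)) (y : W.toSubmodule) :
    ((W.toContRep.integratedOperator hu' hc' η f y : W.toSubmodule) : H) =
      π.integratedOperator hu hc η f (y : H) := by
  rw [ContRepresentation.integratedOperator_apply, ContRepresentation.integratedOperator_apply,
    ← Submodule.subtypeL_apply, ← ContinuousLinearMap.integral_comp_comm _
      (ContRepresentation.integrable_smul_apply hc' η f y)]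
  refine integral_congr_ae (Eventually.of_forall fun g => ?_)
  change W.toSubmodule.subtypeL (f g • W.toContRep g y) = f g • π g (y : H)
  rw [map_smul, Submodule.subtypeL_apply, ContRepresentation.ClosedSubrep.coe_toContRep_apply]

/-- Hence `(W.toContRep)(Φ) ≠ 0` forces `R(Φ) y ≠ 0` for some `y ∈ W`. [folklore] -/
theorem ClosedSubrep.exists_integratedOperator_apply_coe_ne_zero {π : ContRepresentation ℂ G H}
    (hu : π.IsUnitary) (hc : π.IsStronglyContinuous) (W : ContRepresentation.ClosedSubrep π)
    (hu' : W.toContRep.IsUnitary) (hc' : W.toContRep.IsStronglyContinuous)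
    (η : Measure G) [IsFiniteMeasureOnCompacts η] (f : C_c(G, ℂ))
    (h : W.toContRep.integratedOperator hu' hc' η f ≠ 0) :
    ∃ y : W.toSubmodule, π.integratedOperator hu hc η f (y : H) ≠ 0 := by
  by_contra h0
  push Not at h0
  apply h
  ext y
  have := h0 y
  rw [← ClosedSubrep.coe_toContRep_integratedOperator_apply hu hc W hu' hc' η f y] at this
  rw [zero_apply]
  exact_mod_cast this

end Subrep

/-! ### The reduction for a fixed ramified factor -/

section RamifiedFactor

variable {K : Type} [Field K] [NumberField K] {D : Type u} [Ring D] [Algebra K D]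
  [IsQuaternionAlgebra K D]
  {μ_D : Measure (AdelicGroupData.units K D).automorphicQuotient}
  [(AdelicGroupData.units K D).IsAutomorphicMeasure μ_D]
  {μ : Measure (AdelicGroupData.gl 2 K).automorphicQuotient}
  [(AdelicGroupData.gl 2 K).IsAutomorphicMeasure μ]

attribute [local instance] adelicBorel borelSpace_adelic locallyCompactSpace_adelic
  secondCountableTopology_gl_adelic

/-- **The conclusion of `jacquetLanglands_transfer_surjective` for a cuspidal `π`, from a matched
`*`-algebra with a fixed ramified factor `Ξ` not killed by `π`** (Gelbart (1975), Thm. 10.5 (ii):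
proof, pp. 151–156, with `Φ_f = ξ_S ⊗ f`). Let `D` be a division quaternion algebra over `K` with
splittings `θ₀_v` (`v ∉ Ram_f(D)`), `π` a cuspidal automorphic representation of `GL₂(𝔸_K)`, `S` a
finite set of finite places with local Haar measures `μ_v` and `Ξ ∈ C_c(G_S)` such that
`(π ∘ ι_S)(Ξ) ≠ 0` on `π` (with respect to `⊗_{v ∈ S} μ_v`). Let `𝒜` be a `ℂ`-subspace of pairs
`(Φ', Φ) ∈ C_c(D_𝔸ˣ) × C_c(GL₂(𝔸_K))` closed under the involutions, the convolutions and the matched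
left translations at `v ∉ Ram_f(D)`, with the Hilbert–Schmidt trace inequality
`Σ_l ‖R(Φ) e_l‖² ≤ Σ_i ‖R'(Φ') b_i‖² < ∞` on `𝒜`, and containing for every neighbourhood `N` of `1`
in `GL₂(𝔸_K)` a pair `(Φ', Ξ ⊗ θ)` (`GLn.placesTestFunctionCc`) with `θ ≥ 0` continuous compactly
supported, `θ(1) > 0`, `supp θ ⊆ N`. Then some irreducible `πD ≤ L²(D_𝔸ˣ ⧸ ℝ_{>0} Dˣ)` of dimension
`≠ 1` is Hecke-compatible with `π` away from every finite `S'` through every family of splittings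
(`exists_discreteAutomorphicRep_of_testAlgebra` with the non-vanishing
`GLn.exists_nhds_integratedOperator_placesTestFunction_ne_zero`).
[cite: Gelbart1975, Thm. 10.5 (ii) (proof, pp. 151–156), (10.11)–(10.13)] -/
theorem exists_discreteAutomorphicRep_of_ramifiedFactor
    [∀ v : HeightOneSpectrum (𝓞 K), MeasurableSpace (GL (Fin 2) (v.adicCompletion K))]
    [∀ v : HeightOneSpectrum (𝓞 K), BorelSpace (GL (Fin 2) (v.adicCompletion K))]
    [∀ v : HeightOneSpectrum (𝓞 K), SecondCountableTopology (GL (Fin 2) (v.adicCompletion K))]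
    [∀ v : HeightOneSpectrum (𝓞 K), LocallyCompactSpace (GL (Fin 2) (v.adicCompletion K))]
    (θ₀ : ∀ v, v ∉ ramifiedPlaces K D →
      (ScalarExtension K (v.adicCompletion K) D ≃ₐ[v.adicCompletion K]
        Matrix (Fin 2) (Fin 2) (v.adicCompletion K)))
    (hdiv : ∀ x : D, x ≠ 0 → IsUnit x) (π : CuspidalAutomorphicRepGL 2 K μ)
    (S : Finset (HeightOneSpectrum (𝓞 K)))
    (μv : ∀ v : S, Measure (GL (Fin 2) ((v : HeightOneSpectrum (𝓞 K)).adicCompletion K)))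
    [∀ v, (μv v).IsHaarMeasure] [IsFiniteMeasureOnCompacts (Measure.pi μv)]
    (huS : (π.1.toContRep.restrict (GLn.toAdelicPi 2 K S)).IsUnitary)
    (hcS : (π.1.toContRep.restrict (GLn.toAdelicPi 2 K S)).IsStronglyContinuous)
    (Ξ : C_c(GLn.LocalPi 2 K S, ℂ))
    (hΞ : (π.1.toContRep.restrict (GLn.toAdelicPi 2 K S)).integratedOperator huS hcS (Measure.pi μv) Ξ ≠ 0)
    [MeasurableSpace (AdelicGroupData.units K D).Adelic] [BorelSpace (AdelicGroupData.units K D).Adelic]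
    [SecondCountableTopology (AdelicGroupData.units K D).Adelic]
    (η₁ : Measure (AdelicGroupData.units K D).Adelic) [IsFiniteMeasureOnCompacts η₁] [SFinite η₁]
    [η₁.IsMulLeftInvariant] [η₁.IsInvInvariant]
    (𝒜 : Submodule ℂ (C_c((AdelicGroupData.units K D).Adelic, ℂ) × C_c((AdelicGroupData.gl 2 K).Adelic, ℂ)))
    (hstar : ∀ p ∈ 𝒜, ∃ q ∈ 𝒜, (∀ x, q.1 x = mulStar (⇑p.1) x) ∧ (∀ x, q.2 x = mulStar (⇑p.2) x))
    (hconv : ∀ p ∈ 𝒜, ∀ q ∈ 𝒜, ∃ r ∈ 𝒜, (∀ x, r.1 x = mulConv η₁ (⇑p.1) (⇑q.1) x) ∧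
      (∀ x, r.2 x = mulConv (adelicHaar 2 K) (⇑p.2) (⇑q.2) x))
    (htrans : ∀ (v : HeightOneSpectrum (𝓞 K)) (hv : v ∉ ramifiedPlaces K D)
      (l : GL (Fin 2) (v.adicCompletion K)), ∀ p ∈ 𝒜, ∃ q ∈ 𝒜,
        (∀ x : adelicUnits K D,
          q.1 x = p.1 ((Quat.ofLocal K D v ((unitsEquivOfSplitting (θ₀ v hv)).symm l))⁻¹ * x)) ∧
        (∀ x, q.2 x = p.2 ((GLn.toAdelic 2 K v l)⁻¹ * x)))
    {ι₁ ι₂ : Type*} (b : HilbertBasis ι₁ ℂ ((AdelicGroupData.units K D).L2 μ_D))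
    (e : HilbertBasis ι₂ ℂ ((AdelicGroupData.gl 2 K).L2 μ))
    (hHS : ∀ p ∈ 𝒜,
      ∑' l, (‖((AdelicGroupData.gl 2 K).rightRegular μ).integratedOperator
          ((AdelicGroupData.gl 2 K).isUnitary_rightRegular μ)
          ((AdelicGroupData.gl 2 K).isStronglyContinuous_rightRegular_holds μ) (adelicHaar 2 K)
          p.2 (e l)‖₊ : ℝ≥0∞) ^ 2 ≤
        ∑' i, (‖((AdelicGroupData.units K D).rightRegular μ_D).integratedOperator
          ((AdelicGroupData.units K D).isUnitary_rightRegular μ_D)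
          ((AdelicGroupData.units K D).isStronglyContinuous_rightRegular_holds μ_D) η₁
          p.1 (b i)‖₊ : ℝ≥0∞) ^ 2)
    (hfin : ∀ p ∈ 𝒜,
      ∑' i, (‖((AdelicGroupData.units K D).rightRegular μ_D).integratedOperator
          ((AdelicGroupData.units K D).isUnitary_rightRegular μ_D)
          ((AdelicGroupData.units K D).isStronglyContinuous_rightRegular_holds μ_D) η₁
          p.1 (b i)‖₊ : ℝ≥0∞) ^ 2 < ∞)
    (hmem : ∀ N ∈ 𝓝 (1 : (AdelicGroupData.gl 2 K).Adelic),
      ∃ (θ : (AdelicGroupData.gl 2 K).Adelic → ℝ) (hθ : Continuous θ) (hθs : HasCompactSupport θ),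
        0 ≤ θ ∧ 0 < θ 1 ∧ Function.support θ ⊆ N ∧
        ∃ Φ' : C_c((AdelicGroupData.units K D).Adelic, ℂ),
          (Φ', GLn.placesTestFunctionCc Ξ.continuous Ξ.hasCompactSupport
            (Complex.continuous_ofReal.comp hθ) (hθs.comp_left Complex.ofReal_zero)) ∈ 𝒜) :
    ∃ πD : DiscreteAutomorphicRep (AdelicGroupData.units K D) μ_D,
      ¬ πD.IsOneDimensional ∧
      ∀ (S' : Finset (HeightOneSpectrum (𝓞 K)))
        (φ : ∀ v, v ∉ S' → (ScalarExtension K (v.adicCompletion K) D ≃ₐ[v.adicCompletion K]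
          Matrix (Fin 2) (Fin 2) (v.adicCompletion K))),
        HeckeCompatibleAway S' φ πD π := by
  haveI : T2Space (AdelicGroupData.gl 2 K).Adelic := t2Space_gl 2 K
  haveI : ∀ v : HeightOneSpectrum (𝓞 K), T2Space (GL (Fin 2) (v.adicCompletion K)) := fun v =>
    T2Space.of_injective_continuous (f := GLn.toAdelic 2 K v) (GLn.toAdelic_injective)
      (GLn.continuous_toAdelic 2 K v)
  haveI : BorelSpace (GLn.trivialAt 2 K S) := Subtype.borelSpace _
  haveI : SecondCountableTopology (GLn.trivialAt 2 K S) := TopologicalSpace.Subtype.secondCountableTopology _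
  haveI : LocallyCompactSpace (GLn.trivialAt 2 K S) :=
    (GLn.isClosed_trivialAt 2 K S).isClosedEmbedding_subtypeVal.locallyCompactSpace
  -- the constituent `π` as a unitary strongly continuous representation
  set W := π.1 with hW
  have hU := (AdelicGroupData.gl 2 K).isUnitary_rightRegular μ
  have hSC := (AdelicGroupData.gl 2 K).isStronglyContinuous_rightRegular_holds μ
  have huW : W.toContRep.IsUnitary := ClosedSubrep.isUnitary_toContRep hU W
  have hcW : W.toContRep.IsStronglyContinuous := isStronglyContinuous_toContRep W
  -- a Haar measure on `G^S` and the factorisation of `adelicHaar`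
  set μ' : Measure (GLn.trivialAt 2 K S) := Measure.haar with hμ'
  obtain ⟨κ, hκ0, hκ⟩ := GLn.exists_map_placesSplitting_symm_eq_smul_prod (n := 2) (K := K) (S := S)
    (adelicHaar 2 K) μv μ'
  -- non-vanishing of `R(Ξ ⊗ θ)` on `π` for `θ` concentrated at `1`
  obtain ⟨N, hN, hmain⟩ := GLn.exists_nhds_integratedOperator_placesTestFunction_ne_zero huW hcW
    (adelicHaar 2 K) μv μ' hκ0 hκ huS hcS Ξ hΞ
  obtain ⟨θ, hθ, hθs, hθ0, hθ1, hθN, Φ', hmemA⟩ := hmem N hN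
  have hne := hmain θ hθ hθs hθ0 hθ1 hθN
  obtain ⟨y, hy⟩ := ClosedSubrep.exists_integratedOperator_apply_coe_ne_zero hU hSC W huW hcW
    (adelicHaar 2 K) _ hne
  exact exists_discreteAutomorphicRep_of_testAlgebra θ₀ hdiv π η₁ 𝒜 hstar hconv htrans b e hHS hfin
    ⟨_, hmemA, integratedOperatorRestrict_ne_zero_of_exists W _ ⟨y, hy⟩⟩

/-- **The same with the ramified factor a tensor of local factors not killed by the local
components** (Gelbart (1975), pp. 151–153: `ξ_S = ⊗_{v ∈ S} f_v`, `π_v(f_v) ≠ 0`). With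
`Ξ = ⊗_{v ∈ S} ξ_v` (`GLn.tensorCc S ξ`) for a non-empty `S`, the hypothesis `(π ∘ ι_S)(Ξ) ≠ 0`
of `exists_discreteAutomorphicRep_of_ramifiedFactor` follows from `(π ∘ ι_v)(ξ_v) ≠ 0` for each
`v ∈ S` (`GLn.integratedOperator_toAdelicPi_tensorCc_ne_zero`: irreducibility of `π`), which for a
local component `ρ_v` of `π` through an injective intertwiner is a statement about `ρ_v(ξ_v)`
alone (`integratedOperator_restrict_apply_ne_zero`).
[cite: Gelbart1975, Thm. 10.5 (ii) (proof, pp. 151–156), (10.11)–(10.13)] -/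
theorem exists_discreteAutomorphicRep_of_localFactors
    [∀ v : HeightOneSpectrum (𝓞 K), MeasurableSpace (GL (Fin 2) (v.adicCompletion K))]
    [∀ v : HeightOneSpectrum (𝓞 K), BorelSpace (GL (Fin 2) (v.adicCompletion K))]
    [∀ v : HeightOneSpectrum (𝓞 K), SecondCountableTopology (GL (Fin 2) (v.adicCompletion K))]
    [∀ v : HeightOneSpectrum (𝓞 K), LocallyCompactSpace (GL (Fin 2) (v.adicCompletion K))]
    (θ₀ : ∀ v, v ∉ ramifiedPlaces K D →
      (ScalarExtension K (v.adicCompletion K) D ≃ₐ[v.adicCompletion K]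
        Matrix (Fin 2) (Fin 2) (v.adicCompletion K)))
    (hdiv : ∀ x : D, x ≠ 0 → IsUnit x) (π : CuspidalAutomorphicRepGL 2 K μ)
    (S : Finset (HeightOneSpectrum (𝓞 K))) (hS : S.Nonempty)
    (μl : ∀ v : HeightOneSpectrum (𝓞 K), Measure (GL (Fin 2) (v.adicCompletion K)))
    [∀ v, (μl v).IsHaarMeasure]
    (huv : ∀ v, (π.1.toContRep.restrict (GLn.toAdelic 2 K v)).IsUnitary)
    (hcv : ∀ v, (π.1.toContRep.restrict (GLn.toAdelic 2 K v)).IsStronglyContinuous)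
    (ξ : ∀ v : HeightOneSpectrum (𝓞 K), C_c(GL (Fin 2) (v.adicCompletion K), ℂ))
    (h0 : ∀ v ∈ S, (π.1.toContRep.restrict (GLn.toAdelic 2 K v)).integratedOperator (huv v) (hcv v) (μl v) (ξ v) ≠ 0)
    [MeasurableSpace (AdelicGroupData.units K D).Adelic] [BorelSpace (AdelicGroupData.units K D).Adelic]
    [SecondCountableTopology (AdelicGroupData.units K D).Adelic]
    (η₁ : Measure (AdelicGroupData.units K D).Adelic) [IsFiniteMeasureOnCompacts η₁] [SFinite η₁]
    [η₁.IsMulLeftInvariant] [η₁.IsInvInvariant]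
    (𝒜 : Submodule ℂ (C_c((AdelicGroupData.units K D).Adelic, ℂ) × C_c((AdelicGroupData.gl 2 K).Adelic, ℂ)))
    (hstar : ∀ p ∈ 𝒜, ∃ q ∈ 𝒜, (∀ x, q.1 x = mulStar (⇑p.1) x) ∧ (∀ x, q.2 x = mulStar (⇑p.2) x))
    (hconv : ∀ p ∈ 𝒜, ∀ q ∈ 𝒜, ∃ r ∈ 𝒜, (∀ x, r.1 x = mulConv η₁ (⇑p.1) (⇑q.1) x) ∧
      (∀ x, r.2 x = mulConv (adelicHaar 2 K) (⇑p.2) (⇑q.2) x))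
    (htrans : ∀ (v : HeightOneSpectrum (𝓞 K)) (hv : v ∉ ramifiedPlaces K D)
      (l : GL (Fin 2) (v.adicCompletion K)), ∀ p ∈ 𝒜, ∃ q ∈ 𝒜,
        (∀ x : adelicUnits K D,
          q.1 x = p.1 ((Quat.ofLocal K D v ((unitsEquivOfSplitting (θ₀ v hv)).symm l))⁻¹ * x)) ∧
        (∀ x, q.2 x = p.2 ((GLn.toAdelic 2 K v l)⁻¹ * x)))
    {ι₁ ι₂ : Type*} (b : HilbertBasis ι₁ ℂ ((AdelicGroupData.units K D).L2 μ_D))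
    (e : HilbertBasis ι₂ ℂ ((AdelicGroupData.gl 2 K).L2 μ))
    (hHS : ∀ p ∈ 𝒜,
      ∑' l, (‖((AdelicGroupData.gl 2 K).rightRegular μ).integratedOperator
          ((AdelicGroupData.gl 2 K).isUnitary_rightRegular μ)
          ((AdelicGroupData.gl 2 K).isStronglyContinuous_rightRegular_holds μ) (adelicHaar 2 K)
          p.2 (e l)‖₊ : ℝ≥0∞) ^ 2 ≤
        ∑' i, (‖((AdelicGroupData.units K D).rightRegular μ_D).integratedOperator
          ((AdelicGroupData.units K D).isUnitary_rightRegular μ_D)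
          ((AdelicGroupData.units K D).isStronglyContinuous_rightRegular_holds μ_D) η₁
          p.1 (b i)‖₊ : ℝ≥0∞) ^ 2)
    (hfin : ∀ p ∈ 𝒜,
      ∑' i, (‖((AdelicGroupData.units K D).rightRegular μ_D).integratedOperator
          ((AdelicGroupData.units K D).isUnitary_rightRegular μ_D)
          ((AdelicGroupData.units K D).isStronglyContinuous_rightRegular_holds μ_D) η₁
          p.1 (b i)‖₊ : ℝ≥0∞) ^ 2 < ∞)
    (hmem : ∀ N ∈ 𝓝 (1 : (AdelicGroupData.gl 2 K).Adelic),
      ∃ (θ : (AdelicGroupData.gl 2 K).Adelic → ℝ) (hθ : Continuous θ) (hθs : HasCompactSupport θ),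
        0 ≤ θ ∧ 0 < θ 1 ∧ Function.support θ ⊆ N ∧
        ∃ Φ' : C_c((AdelicGroupData.units K D).Adelic, ℂ),
          (Φ', GLn.placesTestFunctionCc (GLn.tensorCc S ξ).continuous (GLn.tensorCc S ξ).hasCompactSupport
            (Complex.continuous_ofReal.comp hθ) (hθs.comp_left Complex.ofReal_zero)) ∈ 𝒜) :
    ∃ πD : DiscreteAutomorphicRep (AdelicGroupData.units K D) μ_D,
      ¬ πD.IsOneDimensional ∧
      ∀ (S' : Finset (HeightOneSpectrum (𝓞 K)))
        (φ : ∀ v, v ∉ S' → (ScalarExtension K (v.adicCompletion K) D ≃ₐ[v.adicCompletion K]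
          Matrix (Fin 2) (Fin 2) (v.adicCompletion K))),
        HeckeCompatibleAway S' φ πD π := by
  haveI : IsFiniteMeasureOnCompacts (Measure.pi fun v : S => μl v) := GLn.isFiniteMeasureOnCompacts_pi S μl
  have hU := (AdelicGroupData.gl 2 K).isUnitary_rightRegular μ
  have huW : π.1.toContRep.IsUnitary := ClosedSubrep.isUnitary_toContRep hU π.1
  have hcW : π.1.toContRep.IsStronglyContinuous := isStronglyContinuous_toContRep π.1
  have huS : (π.1.toContRep.restrict (GLn.toAdelicPi 2 K S)).IsUnitary := huW.restrict _
  have hcS : (π.1.toContRep.restrict (GLn.toAdelicPi 2 K S)).IsStronglyContinuous :=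
    hcW.restrict _ (GLn.continuous_toAdelicPi 2 K S)
  have hΞ := GLn.integratedOperator_toAdelicPi_tensorCc_ne_zero π.1.toContRep π.2.2 huW hcW μl ξ S hS
    huS hcS huv hcv h0
  exact exists_discreteAutomorphicRep_of_ramifiedFactor θ₀ hdiv π S (fun v : S => μl v) huS hcS
    (GLn.tensorCc S ξ) hΞ η₁ 𝒜 hstar hconv htrans b e hHS hfin hmem

end RamifiedFactor

end Literature.NumberTheory.Automorphic
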